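/-
Copyright: public-domain mathematics; typed transcription for the H21 Literature library (cell pub-balaban, PAPER SUB-CELL B05 gen 6).

# Bałaban, *Propagators and renormalization transformations for lattice gauge theories. I*,
# Commun. Math. Phys. **95** (1984) 17–40 — CONSTRUCTION of the averaging kernel `Q_k` of (1.18)/(1.120) on the
# finite torus and (1.128) for `Δ_w + aQ_k*Q_k + (decaying kernel)` with every structural hypothesis discharged

[cite: Balaban1984PropagatorsI]  T. Bałaban, Commun. Math. Phys. 95 (1984) 17–40 (= B5 of the series).  Quotations
(read by this seat from the page renders `1984-cmp95-propagators-rt-I-p002-x2.png`, `…-p004-x2.png`, `…-p021-x2.png`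
as images; journal page = PDF page + 16):

p. 18 [PDF 2], (1.6): «We define a new lattice T_L^{(1)} = T₁ ∩ LZ^d and we divide T₁ into blocks B(y) parametrized by
the points of T_L^{(1)}: B(y) = {x ∈ T₁ : y_μ ≤ x_μ < y_μ + L, μ = 1, …, d}, y ∈ T_L^{(1)}. (1.6)»
p. 20 [PDF 4], (1.18): «(Q_k A)_b = Σ_{x∈B^k(b₋)} η^{d+1} A([x, x(b)]), b ⊂ T₁^{(k)} = Z^d ∩ T_η, η = L^{−k}, (1.18)
and x(b) is a point in B^k(b₊) obtained from x by translation by b. If b = ⟨y, y + e_μ⟩, then x(b) = x + e_μ.»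
(with p. 19 [PDF 3], after (1.8): «where A(Γ) = Σ_{b⊂Γ} A_b for arbitrary contour Γ»).
p. 37 [PDF 21], (1.120) line 2 (quoted also in the header of `B5Averaging120`):
«(QhA)_μ(y) = Σ_{x∈B^k(y)} η^d (hA_μ)([x, x^{(k)}]) = h(y)(QA)_μ(y) + Σ_{x∈B^k(y)} η^d Σ_{x₁∈[x,x^{(k)}[} η(∂h)(Γ_{y,x} ∪
[x, x₁])A_μ(x₁) = h(y)(QA)_μ(y) + (S(∂h)A)_μ(y),».

WHAT THIS MODULE IS.  Second module of gen 6 (after `B5Averaging120`, which types `Q`, `Q*`, `S(∂h)`, `S*(∂h)`,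
`P₁(∂h)` as abstract rectangular kernel operators and proves (1.128) for `Δ_w + a·Q*Q + k` under HYPOTHESES on the
averaging kernel `q`: bounded support, absolute row sums `≤ R_row`, absolute column sums `≤ C_col`).  THIS FILE
CONSTRUCTS Bałaban's kernel (1.18) on the finite torus and DISCHARGES those hypotheses, so that the torus-model (1.128)
leaf for `Δ_model = Δ_w + aQ_k*Q_k + (∂P∂*-kernel)` on vector fields has exactly ONE analytic hypothesis left: the decay
(1.126) of the `∂P∂*` kernel (B4 territory, cell GAPS G-B5-31 (b)).

THE MODEL (fine torus `UT N` of `B5TorusCover`, `N_i` sites per axis, sup circular distance; block side `n = L^k`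
fine steps, i.e. `η = 1/n`; coarse points `Ctr N n` of `B5TorusCover` — the points `(n·y_i)_i`, `y_i < N_i/n` — standing
for `T₁^{(k)} ⊂ T_η`; fine components `UT N × Fin d` (a vector field `A_ν(x₁)`), coarse components `Ctr N n × Fin d`
(`(Q_kA)_μ(y)`)).
§1 `rot`, `shift` (translation of a torus site by a vector of naturals) with `dist_shift_le` (a translation by `v`
moves a site by at most `max_i v_i` in the sup circular distance); `segVec`/`segPt`: the fine site `n·y + j + t·e_μ`
(`j ∈ [0,n)^d` the position in the block `B^k(y)`, `t < n` the position on the segment `[x, x + e_μ]`, `x = n·y + j`);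
`segPt_val` (coordinates) and `segPt_inj`: for fixed `t`, `(y, j) ↦ n·y + j + t·e_μ` is injective when every axis holds
at least one full block (`1 ≤ N_i/n`; Euclidean division, `B5TorusCover.blockMap_injective`, plus cancellation of `t`
modulo `N_μ`).
§2 THE KERNEL (1.18): `avgKer n (y, μ) (x₁, ν) = δ_{μν}·#{(j, t) : x₁ = n·y + j + t·e_μ}/n^{d+1}` — the weight
`η^{d+1}` times the number of block points `x ∈ B^k(y)` whose segment `[x, x + e_μ]` contains the bond
`⟨x₁, x₁ + ηe_μ⟩`.  PROVED: `avgKer_nonneg`; `avgKer_rowsum` (`Σ_{(x₁,ν)} q = 1` exactly: the `n^d·n` pairs `(j,t)`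
each contribute `η^{d+1}` — every row of `Q_k` is a probability vector, `R_row = 1`); `avgKer_colsum_le`
(`Σ_{(y,μ)} q ≤ n^{−d}`: for each of the `n` values of `t` at most one `(y, j)`, by `segPt_inj` — `C_col = η^d`);
`dist_le_of_avgKer_ne_zero` (support: `q ≠ 0 ⇒ dist(n·y, x₁) ≤ 2n`); `fibre_card_fst` (the component fibres of
`UT N × Fin d → UT N` have `d` elements).
§3 (1.128) FOR `Δ_model = kerOp (lapKer axisWC + a·gram120 (n^d) (avgKer n)) + kerOp k` ON VECTOR FIELDS
(`h128_balaban_torus`): `B5Averaging120.h128_gram_torus` with `q := avgKer n`, `τ := n^d` (`= η^{−d}`), `r := 2n`,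
`C_col := n^{−d}`, `R_row := 1`, `w := B5Leibniz121.axisWC` (the componentwise axis Laplacian, `isAxisLap_prod`),
fibres `m := d` — every structural hypothesis DISCHARGED; the remaining hypotheses are the decay (1.126) of `k`
(`|k_ij| ≤ C e^{−δ dist}`), `1 ≤ n`, `1 ≤ N_i/n`, `2M₀ ≤ N_i`, and a gradient operator `Dg` dominating
`√(dirichlet axisWC A)`.  Constant: `((4d/M₀)√(2d) + 52d/M₀² + (4d/M₀)·4n·|a|)·e^{4+4n/M₀} +
(4d/M₀)·C·(24/(eδ))·d·K_d(δ/8)·e⁷` with `M₀` the cube size IN FINE STEPS (`M₀ = M₀′ = M₀^{print}·n`): the `Q`-term is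
`16d·n|a|/M₀′ = 16d|a|/M₀^{print}` and `e^{4n/M₀′} = e^{4/M₀^{print}}` — UNIFORM in `η = 1/n`, the printed `O(M₀⁻¹)`.

DIVERGENCES (cell DIVERGENCE.md, D-b05g6.2).  (i) The torus need not be tiled exactly (`1 ≤ N_i/n`, not `n ∣ N_i`):
the coarse points are `B5TorusCover`'s sparse centre set; with `n ∣ N_i` it is exactly `T₁^{(k)}` and the column sums
are `= n^{−d}`; only the upper bounds are used.  (ii) Weight ratio `τ = n^d = η^{−d}` as in `B5Averaging120` (ii).
(iii) `M₀` of this file is the cube size in FINE steps; the printed `M₀` is `M₀/n` (dictionary above).  (iv) The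
Laplacian is the componentwise axis Laplacian `axisWC` of `B5Leibniz121` §3b in the `lapKer` sign convention
(`B5Averaging120.norm_Kop_neg` for the printed sign); the identification of Bałaban's `Δ` on 1-forms with it, and of
the coarse multiplier `h(y)` with `hS_z` at `n·y`, are as in D-b05g5.5 / D-b05g6.1.  (v) (1.126) stays a HYPOTHESIS.

HONEST LABELLING.  Nothing here is a claim of the paper beyond the displays quoted; every statement is kernel-proved;
decls marked MODEL / CONSTRUCTION are this library's; [folklore] marks elementary facts.  Imports: `B5Averaging120`
(hence `B5Leibniz121`, `B5Commutator128`, `B5SmoothPartition`, `B5TorusCover`) and Mathlib.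
value = kernel certificate of a located leaf (the averaging kernel of (1.18) constructed on the torus with its
support / row / column data, and (1.128) for `Δ_w + aQ_k*Q_k + k` with only (1.126) left as hypothesis) — NOT summit
progress.
-/
import Mathlib
import Literature.MathematicalPhysics.QuantumFieldTheory.Balaban1983to89.B5Averaging120

open Finset

namespace Literature.MathematicalPhysics.QuantumFieldTheory.Balaban1983to89.B5AveragingTorus

open B5TorusCover (UT Ctr ctrU ctr nC blockMap blockMap_injective block_lt)
open B4Sect5Torus (TSite ccoord tdist ccoord_cast)
open B4TorusKernel.MultiPeriod (circAbs circAbs_le_abs circAbs_add_mul)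
open B5Commutator128 (kerOp)
open B5SmoothPartition (HSop)
open B5Leibniz121 (lapKer dirichlet IsAxisLap axisWC isAxisLap_prod)
open B5Averaging120 (gram120 h128_gram_torus)
open B5Local114 (Kop)
open B5Walk131 (twoDelta0)

noncomputable section

/-! ## §1  Translations on the finite torus; the block/segment sites `n·y + j + t·e_μ` -/

section Shift

/-- Rotation of a residue by a natural number: `rot a v = (a + v) mod n`. [folklore] -/
def rot {n : ℕ} (a : Fin n) (v : ℕ) : Fin n := ⟨(a.val + v) % n, Nat.mod_lt _ a.pos⟩

/-- The value of `rot a v`. [folklore] -/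
@[simp] theorem rot_val {n : ℕ} (a : Fin n) (v : ℕ) : (rot a v).val = (a.val + v) % n := rfl

/-- On one circle, rotating by `v` moves a residue by at most `v` in the circular distance. [folklore] -/
theorem circAbs_rot_le {n : ℕ} (hn : 1 ≤ n) (a : Fin n) (v : ℕ) :
    circAbs n ((a.val : ℤ) - ((rot a v).val : ℤ)) ≤ v := by
  rw [rot_val]
  have h1 : ((((a.val + v) % n : ℕ)) : ℤ) + (n : ℤ) * (((a.val + v) / n : ℕ) : ℤ) = (a.val : ℤ) + (v : ℤ) := by
    have h := Nat.mod_add_div (a.val + v) n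
    exact_mod_cast h
  have key : (a.val : ℤ) - (((a.val + v) % n : ℕ) : ℤ) = -(v : ℤ) + (n : ℤ) * (((a.val + v) / n : ℕ) : ℤ) := by
    linarith
  rw [key, circAbs_add_mul]
  have h2 := circAbs_le_abs hn (-(v : ℤ))
  rwa [abs_neg, Nat.abs_cast] at h2

variable {d : ℕ} {N : Fin d → ℕ}

/-- Translation of a torus site by a vector of naturals (coordinatewise rotation). [folklore] -/
def shift (x : UT N) (v : Fin d → ℕ) : UT N := UT.ofSite N fun i => rot (UT.toSite N x i) (v i)

/-- Coordinates of a translated site. [folklore] -/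
@[simp] theorem shift_val (x : UT N) (v : Fin d → ℕ) (i : Fin d) :
    (UT.toSite N (shift x v) i).val = ((UT.toSite N x i).val + v i) % N i := rfl

/-- The component fibres of `UT N × Fin d → UT N` have exactly `d` elements (the datum `m` of
`B5Averaging120.h128_gram_torus`). [folklore] -/
theorem fibre_card_fst (y : UT N) :
    ((Finset.univ.filter fun p : UT N × Fin d => p.1 = y).card : ℝ) ≤ d := by
  have h : (Finset.univ.filter fun p : UT N × Fin d => p.1 = y)
      = ({y} : Finset (UT N)) ×ˢ (Finset.univ : Finset (Fin d)) := by
    ext p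
    simp only [Finset.mem_filter, Finset.mem_univ, true_and, Finset.mem_product, Finset.mem_singleton, and_true]
  rw [h, Finset.card_product, Finset.card_singleton, one_mul, Finset.card_univ, Fintype.card_fin]

variable [∀ i, NeZero (N i)]

/-- Each coordinate distance between a site and its translate by `v` is `≤ v_i`. [folklore] -/
theorem ccoord_shift_le (x : UT N) (v : Fin d → ℕ) (i : Fin d) :
    ((ccoord N (UT.toSite N x) (UT.toSite N (shift x v)) i : ℕ) : ℤ) ≤ v i := by
  rw [ccoord_cast (UT.one_le N)]
  exact circAbs_rot_le (UT.one_le N i) (UT.toSite N x i) (v i)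

/-- **A translation by `v` with all `v_i ≤ B` moves a site by at most `B`** in the sup circular distance.
[folklore] -/
theorem dist_shift_le (x : UT N) {v : Fin d → ℕ} {B : ℕ} (hv : ∀ i, v i ≤ B) :
    dist x (shift x v) ≤ (B : ℝ) := by
  rw [UT.dist_eq]
  unfold tdist
  have hsup : Finset.univ.sup (ccoord N (UT.toSite N x) (UT.toSite N (shift x v))) ≤ B := by
    apply Finset.sup_le
    intro i _
    have h := ccoord_shift_le x v i
    have h' : (v i : ℤ) ≤ B := by exact_mod_cast hv i
    exact_mod_cast h.trans h'
  exact_mod_cast hsup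

/-- Coordinates of the coarse point `n·y`. [folklore] -/
@[simp] theorem ctrU_val (n : ℕ) (y : Ctr N n) (i : Fin d) : (UT.toSite N (ctrU N n y) i).val = n * (y i).val :=
  rfl

/-- MODEL. The translation vector `j + t·e_μ` of a block position `j ∈ [0,n)^d` and a segment position `t < n` in
direction `μ`. [cite: Balaban1984PropagatorsI, (1.18) p.20 (x ∈ B^k(b₋) and the segment [x, x(b)])] -/
def segVec (n : ℕ) (μ : Fin d) (p : (Fin d → Fin n) × Fin n) : Fin d → ℕ :=
  fun i => (p.1 i).val + if i = μ then p.2.val else 0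

/-- MODEL. The fine site `n·y + j + t·e_μ`: the `t`-th site of the segment `[x, x + e_μ]` from the block point
`x = n·y + j ∈ B^k(y)`. [cite: Balaban1984PropagatorsI, (1.18) p.20, (1.6) p.18] -/
def segPt (n : ℕ) (y : Ctr N n) (μ : Fin d) (p : (Fin d → Fin n) × Fin n) : UT N :=
  shift (ctrU N n y) (segVec n μ p)

/-- Coordinates of `n·y + j + t·e_μ`. [folklore] -/
theorem segPt_val (n : ℕ) (y : Ctr N n) (μ : Fin d) (p : (Fin d → Fin n) × Fin n) (i : Fin d) :
    (UT.toSite N (segPt n y μ p) i).val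
      = (n * (y i).val + ((p.1 i).val + if i = μ then p.2.val else 0)) % N i := rfl

/-- Every component of `j + t·e_μ` is `≤ 2n`. [folklore] -/
theorem segVec_le (n : ℕ) (μ : Fin d) (p : (Fin d → Fin n) × Fin n) (i : Fin d) : segVec n μ p i ≤ 2 * n := by
  unfold segVec
  have h1 := (p.1 i).isLt
  have h2 := p.2.isLt
  split_ifs <;> omega

/-- `n·y + j + t·e_μ` lies within sup distance `2n` of the coarse point `n·y`. [folklore] -/
theorem dist_segPt_le (n : ℕ) (y : Ctr N n) (μ : Fin d) (p : (Fin d → Fin n) × Fin n) :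
    dist (ctrU N n y) (segPt n y μ p) ≤ 2 * (n : ℝ) := by
  have h := dist_shift_le (ctrU N n y) (v := segVec n μ p) (B := 2 * n) (segVec_le n μ p)
  unfold segPt
  exact_mod_cast h

/-- One axis: `(k, j) ↦ (n·k + j + c) mod N` is injective on `Fin (N/n) × Fin n` for every fixed `c`, as soon as the
axis holds a full block (`1 ≤ N/n`) — Euclidean division (`blockMap_injective`) after cancelling `c` modulo `N`.
[folklore] -/
theorem axis_inj {Nax n : ℕ} (hq : 1 ≤ Nax / n) (c : ℕ) {k k' : Fin (nC Nax n)} {j j' : Fin n}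
    (h : (n * k.val + (j.val + c)) % Nax = (n * k'.val + (j'.val + c)) % Nax) : k = k' ∧ j = j' := by
  have hA : j.val + n * k.val < Nax := block_lt hq k j
  have hA' : j'.val + n * k'.val < Nax := block_lt hq k' j'
  have h' : (j.val + n * k.val + c) % Nax = (j'.val + n * k'.val + c) % Nax := by
    rwa [show n * k.val + (j.val + c) = j.val + n * k.val + c by ring,
      show n * k'.val + (j'.val + c) = j'.val + n * k'.val + c by ring] at h
  have hmod : Nat.ModEq Nax (j.val + n * k.val + c) (j'.val + n * k'.val + c) := h'
  have hmod' : Nat.ModEq Nax (j.val + n * k.val) (j'.val + n * k'.val) := Nat.ModEq.add_right_cancel' c hmod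
  have heq : j.val + n * k.val = j'.val + n * k'.val := Nat.ModEq.eq_of_lt_of_lt hmod' hA hA'
  have hb : blockMap hq (k, j) = blockMap hq (k', j') := Fin.ext heq
  have hp := blockMap_injective hq hb
  exact ⟨(Prod.mk.inj hp).1, (Prod.mk.inj hp).2⟩

/-- **For fixed segment position `t`, `(y, j) ↦ n·y + j + t·e_μ` is injective** (every axis holding a full block).
[folklore] -/
theorem segPt_inj {n : ℕ} (hq : ∀ i, 1 ≤ N i / n) (μ : Fin d) (t : Fin n) {y y' : Ctr N n}
    {j j' : Fin d → Fin n} (h : segPt n y μ (j, t) = segPt n y' μ (j', t)) : y = y' ∧ j = j' := by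
  have hc : ∀ i, y i = y' i ∧ j i = j' i := by
    intro i
    have hi := congrArg (fun z : UT N => (UT.toSite N z i).val) h
    simp only [segPt_val] at hi
    exact axis_inj (hq i) _ hi
  exact ⟨funext fun i => (hc i).1, funext fun i => (hc i).2⟩

end Shift

/-! ## §2  CONSTRUCTION: Bałaban's averaging kernel `Q_k` of (1.18) on the torus and its support / row / column data -/

section Kernel

variable {d : ℕ} {N : Fin d → ℕ} [∀ i, NeZero (N i)]

/-- CONSTRUCTION. **The averaging kernel of (1.18)/(1.120)** between vector-field components:
`avgKer n (y, μ) (x₁, ν) = δ_{μν} · #{(j, t) ∈ [0,n)^d × [0,n) : x₁ = n·y + j + t·e_μ} / n^{d+1}` — the weight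
`η^{d+1}` (`η = 1/n`) times the number of block points `x = n·y + j ∈ B^k(y)` whose segment `[x, x + e_μ]` (the `n`
bonds `⟨x + tηe_μ, x + (t+1)ηe_μ⟩`) contains the bond at `x₁`; so that
`(Q_kA)_μ(y) = Σ_{(x₁,ν)} avgKer n (y,μ) (x₁,ν) A_ν(x₁) = Σ_{x∈B^k(y)} η^{d+1} A_μ([x, x + e_μ])`.
[cite: Balaban1984PropagatorsI, (1.18) p.20, (1.120) p.37 line 2] -/
def avgKer (n : ℕ) (c : Ctr N n × Fin d) (b : UT N × Fin d) : ℝ :=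
  if c.2 = b.2 then
    ((Finset.univ.filter fun p : (Fin d → Fin n) × Fin n => segPt n c.1 c.2 p = b.1).card : ℝ)
      / (n : ℝ) ^ (d + 1)
  else 0

/-- The averaging kernel is nonnegative. [folklore] -/
theorem avgKer_nonneg (n : ℕ) (c : Ctr N n × Fin d) (b : UT N × Fin d) : 0 ≤ avgKer n c b := by
  unfold avgKer
  split_ifs
  · positivity
  · exact le_rfl

/-- **Support**: `avgKer n (y,μ) (x₁,ν) ≠ 0 ⇒ dist(n·y, x₁) ≤ 2n` (the bond lies on a segment from a point of the
block `B^k(y)`). [cite: Balaban1984PropagatorsI, (1.18) p.20 with (1.6) p.18] -/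
theorem dist_le_of_avgKer_ne_zero (n : ℕ) (c : Ctr N n × Fin d) (b : UT N × Fin d) (h : avgKer n c b ≠ 0) :
    dist (ctrU N n c.1) b.1 ≤ 2 * (n : ℝ) := by
  unfold avgKer at h
  split_ifs at h with hμ
  · have hne : (Finset.univ.filter fun p : (Fin d → Fin n) × Fin n => segPt n c.1 c.2 p = b.1).Nonempty := by
      rw [Finset.nonempty_iff_ne_empty]
      intro he
      apply h
      rw [he, Finset.card_empty, Nat.cast_zero, zero_div]
    obtain ⟨p, hp⟩ := hne
    rw [Finset.mem_filter] at hp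
    rw [← hp.2]
    exact dist_segPt_le n c.1 c.2 p
  · exact absurd rfl h

/-- **Row sums: every row of `Q_k` is a probability vector**, `Σ_{(x₁,ν)} avgKer n (y,μ) (x₁,ν) = 1` (`n ≥ 1`): the
`n^d·n` pairs `(j, t)` each contribute `η^{d+1}`. [cite: Balaban1984PropagatorsI, (1.18) p.20] -/
theorem avgKer_rowsum {n : ℕ} (hn : 1 ≤ n) (c : Ctr N n × Fin d) : ∑ b : UT N × Fin d, avgKer n c b = 1 := by
  obtain ⟨y, μ⟩ := c
  have hn0 : (0 : ℝ) < n := by exact_mod_cast hn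
  rw [Fintype.sum_prod_type]
  simp only [avgKer, Finset.sum_ite_eq, Finset.mem_univ, if_true]
  rw [← Finset.sum_div]
  have hnat : ∑ x : UT N, (Finset.univ.filter fun p : (Fin d → Fin n) × Fin n => segPt n y μ p = x).card
      = (Finset.univ : Finset ((Fin d → Fin n) × Fin n)).card :=
    (Finset.card_eq_sum_card_fiberwise (f := fun p : (Fin d → Fin n) × Fin n => segPt n y μ p)
      (s := Finset.univ) (t := Finset.univ) fun _ _ => Finset.mem_univ _).symm
  have hcard : (Finset.univ : Finset ((Fin d → Fin n) × Fin n)).card = n ^ (d + 1) := by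
    rw [Finset.card_univ, Fintype.card_prod, Fintype.card_pi, Fintype.card_fin, Finset.prod_const,
      Finset.card_univ, Fintype.card_fin, pow_succ]
  have hsum : (∑ x : UT N, ((Finset.univ.filter
      fun p : (Fin d → Fin n) × Fin n => segPt n y μ p = x).card : ℝ)) = (n : ℝ) ^ (d + 1) := by
    exact_mod_cast hnat.trans hcard
  rw [hsum, div_self (pow_ne_zero _ hn0.ne')]

/-- Absolute row sums of `Q_k` are `≤ 1` (the datum `R_row` of `B5Averaging120.h128_gram_torus`). [folklore] -/
theorem avgKer_abs_rowsum_le {n : ℕ} (hn : 1 ≤ n) (c : Ctr N n × Fin d) :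
    ∑ b : UT N × Fin d, |avgKer n c b| ≤ 1 := by
  rw [← avgKer_rowsum (N := N) hn c]
  exact le_of_eq (Finset.sum_congr rfl fun b _ => abs_of_nonneg (avgKer_nonneg n c b))

/-- **Column sums: `Σ_{(y,μ)} avgKer n (y,μ) (x₁,ν) ≤ n^{−d}`** — every fine bond lies on at most `n` of the
averaging segments (for each segment position `t` at most one `(y, j)`, `segPt_inj`), each of weight `η^{d+1}`;
requires a full block on every axis (`1 ≤ N_i/n`).  (The datum `C_col = η^d` of `B5Averaging120.h128_gram_torus`.)
[cite: Balaban1984PropagatorsI, (1.18) p.20] -/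
theorem avgKer_colsum_le {n : ℕ} (hn : 1 ≤ n) (hq : ∀ i, 1 ≤ N i / n) (b : UT N × Fin d) :
    ∑ c : Ctr N n × Fin d, |avgKer n c b| ≤ 1 / (n : ℝ) ^ d := by
  obtain ⟨x, ν⟩ := b
  have hn0 : (0 : ℝ) < n := by exact_mod_cast hn
  have habs : ∀ c : Ctr N n × Fin d, |avgKer n c (x, ν)| = avgKer n c (x, ν) :=
    fun c => abs_of_nonneg (avgKer_nonneg n c _)
  simp only [habs]
  rw [Fintype.sum_prod_type]
  simp only [avgKer, Finset.sum_ite_eq', Finset.mem_univ, if_true]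
  rw [← Finset.sum_div]
  have hnat : ∑ y : Ctr N n, (Finset.univ.filter fun p : (Fin d → Fin n) × Fin n => segPt n y ν p = x).card
      ≤ n := by
    calc ∑ y : Ctr N n, (Finset.univ.filter fun p : (Fin d → Fin n) × Fin n => segPt n y ν p = x).card
        = ∑ y : Ctr N n, ∑ p : (Fin d → Fin n) × Fin n, (if segPt n y ν p = x then 1 else 0) :=
          Finset.sum_congr rfl fun y _ => by rw [Finset.card_filter]
      _ = ∑ y : Ctr N n, ∑ t : Fin n, ∑ j : Fin d → Fin n, (if segPt n y ν (j, t) = x then 1 else 0) :=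
          Finset.sum_congr rfl fun y _ => by
            rw [Fintype.sum_prod_type (fun p : (Fin d → Fin n) × Fin n => if segPt n y ν p = x then 1 else 0),
              Finset.sum_comm]
      _ = ∑ t : Fin n, ∑ y : Ctr N n, ∑ j : Fin d → Fin n, (if segPt n y ν (j, t) = x then 1 else 0) :=
          Finset.sum_comm
      _ = ∑ t : Fin n, ∑ yj : Ctr N n × (Fin d → Fin n), (if segPt n yj.1 ν (yj.2, t) = x then 1 else 0) :=
          Finset.sum_congr rfl fun t _ =>
            (Fintype.sum_prod_type
              (fun yj : Ctr N n × (Fin d → Fin n) => if segPt n yj.1 ν (yj.2, t) = x then 1 else 0)).symm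
      _ ≤ ∑ _t : Fin n, 1 := by
          refine Finset.sum_le_sum fun t _ => ?_
          have hle : (Finset.univ.filter
              fun yj : Ctr N n × (Fin d → Fin n) => segPt n yj.1 ν (yj.2, t) = x).card ≤ 1 := by
            refine Finset.card_le_one.mpr fun a ha b hb => ?_
            rw [Finset.mem_filter] at ha hb
            have hab := segPt_inj hq ν t (ha.2.trans hb.2.symm)
            exact Prod.ext hab.1 hab.2
          calc ∑ yj : Ctr N n × (Fin d → Fin n), (if segPt n yj.1 ν (yj.2, t) = x then 1 else 0)
              = (Finset.univ.filter fun yj : Ctr N n × (Fin d → Fin n) => segPt n yj.1 ν (yj.2, t) = x).card := by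
                rw [Finset.card_filter]
            _ ≤ 1 := hle
      _ = n := by rw [Finset.sum_const, Finset.card_univ, Fintype.card_fin, smul_eq_mul, mul_one]
  have hreal : (∑ y : Ctr N n, ((Finset.univ.filter
      fun p : (Fin d → Fin n) × Fin n => segPt n y ν p = x).card : ℝ)) ≤ n := by
    exact_mod_cast hnat
  calc (∑ y : Ctr N n, ((Finset.univ.filter
        fun p : (Fin d → Fin n) × Fin n => segPt n y ν p = x).card : ℝ)) / (n : ℝ) ^ (d + 1)
      ≤ (n : ℝ) / (n : ℝ) ^ (d + 1) := div_le_div_of_nonneg_right hreal (by positivity)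
    _ = 1 / (n : ℝ) ^ d := by
        field_simp
        ring

end Kernel

/-! ## §3  (1.128) for `Δ_model = Δ_w + aQ_k*Q_k + (decaying kernel)` on vector fields, every structural hypothesis
discharged -/

section Assembly

variable {d : ℕ} {N : Fin d → ℕ} [∀ i, NeZero (N i)]

/-- **(1.128) FOR `Δ_model = kerOp (lapKer axisWC + a·gram120 (n^d) (avgKer n)) + kerOp k` ON VECTOR FIELDS OVER THE
TORUS, ALL STRUCTURAL HYPOTHESES DISCHARGED.**  For the componentwise axis Laplacian `axisWC`, Bałaban's averaging
kernel `Q_k = rectOp (avgKer n)` with weight ratio `τ = n^d` (so `a·gram120 (n^d) (avgKer n)` is the kernel of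
`aQ_k*Q_k`), block side `n ≥ 1` with a full block on every axis, the smooth partition of cube size `M₀` (in fine steps,
`2M₀ ≤ N_i`), and ANY kernel `k` with the decay (1.126) (HYPOTHESIS, B4 territory), the bound (1.128) holds at rate
`twoDelta0 δ M₀` with the explicit constant
`((4d/M₀)√(2d) + 52d/M₀² + (4d/M₀)·4n·|a|)·e^{4+4n/M₀} + (4d/M₀)·C·(24/(eδ))·d·K_d(δ/8)·e⁷`
— with `M₀ = M₀^{print}·n` the `Q`-term is `16d|a|/M₀^{print}`, uniformly in `η = 1/n`.
[cite: Balaban1984PropagatorsI, (1.128) p.38 with (1.121) p.37, (1.18) p.20, (1.126) p.38] -/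
theorem h128_balaban_torus {M₀ n : ℕ} (hM : 1 ≤ M₀) (h2N : ∀ i, 2 * M₀ ≤ N i) (hn : 1 ≤ n)
    (hq : ∀ i, 1 ≤ N i / n) {Dg : Module.End ℝ (EuclideanSpace ℝ (UT N × Fin d))}
    (hDg : ∀ A, Real.sqrt (dirichlet (axisWC (N := N) (κ := Fin d)) A) ≤ ‖Dg A‖) (a : ℝ)
    {k : UT N × Fin d → UT N × Fin d → ℝ} {C δ : ℝ}
    (decay : ∀ i j, |k i j| ≤ C * Real.exp (-(δ * dist i.1 j.1))) (hC : 0 ≤ C) (hδ : 0 < δ)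
    (z₁ z₂ : Ctr N M₀) (A : EuclideanSpace ℝ (UT N × Fin d)) :
    ‖HSop N M₀ (fun p : UT N × Fin d => p.1) z₁
        (Kop (kerOp (fun i j => lapKer axisWC i j + a * gram120 ((n : ℝ) ^ d) (avgKer n) i j) + kerOp k)
          (HSop N M₀ fun p : UT N × Fin d => p.1) z₂ A)‖
      ≤ (((4 * d / M₀ * Real.sqrt (2 * d) + 52 * d / (M₀ : ℝ) ^ 2) + 4 * d / M₀ * (4 * n) * |a|)
              * Real.exp (4 + 4 * n / M₀)
          + 4 * d / M₀ * C * (24 / (Real.exp 1 * δ)) * (d * B4Sect5Proof.latticeConst d (δ / 8))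
            * Real.exp 7)
        * Real.exp (-(twoDelta0 δ M₀ * dist (ctrU N M₀ z₁) (ctrU N M₀ z₂))) * (‖Dg A‖ + ‖A‖) := by
  have hn0 : (0 : ℝ) < n := by exact_mod_cast hn
  have hr : (1 : ℝ) ≤ 2 * (2 * (n : ℝ)) := by
    have : (1 : ℝ) ≤ n := by exact_mod_cast hn
    linarith
  have h := h128_gram_torus (N := N) (ι := UT N × Fin d) (κ := Ctr N n × Fin d) hM h2N
    (fun p : UT N × Fin d => p.1) (m := d) fibre_card_fst isAxisLap_prod hDg
    (fun c : Ctr N n × Fin d => ctrU N n c.1) (q := avgKer n) (r := 2 * (n : ℝ)) (τ := (n : ℝ) ^ d)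
    (Ccol := 1 / (n : ℝ) ^ d) (Rrow := 1) a hr (by positivity) zero_le_one (by positivity)
    (fun c i hci => dist_le_of_avgKer_ne_zero n c i hci) (avgKer_colsum_le hn hq)
    (avgKer_abs_rowsum_le hn) decay hC hδ z₁ z₂ A
  have e1 : |a| * ((n : ℝ) ^ d * (1 / (n : ℝ) ^ d) * 1) = |a| := by
    field_simp
  have e2 : 2 * (2 * (n : ℝ)) = 4 * n := by ring
  rw [e1, e2] at h
  exact h

end Assembly

end

end Literature.MathematicalPhysics.QuantumFieldTheory.Balaban1983to89.B5AveragingTorus
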